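import Literature.Algebra.EuclideanLattices.RegevPointSet
import HarnessLib

/-!
# Regev 2004, Claim 3.14 for the point set: the shift estimate as a fraction of the set

Topic `Algebra/EuclideanLattices` (family `pqc`); proved material towards the discharge of the
named fact `Literature.Algebra.EuclideanLattices.usvp_of_dihedralCoset` (O. Regev, *Quantum
computation and lattice problems*, SIAM J. Comput. 33 (2004) 738–760, Thm. 1.1). No named fact is
introduced; everything is proved.

`RegevPointSet.lean` bounds, for the point set `X = pointSet (m+1) Q Δ` of a register and a shift
`s ∈ ℤ^{m+1}`, the number of points leaving `X` by three volumes
(`card_filter_sub_notMem_le_volume`: `[V(R′) − V(r′)] + ‖s‖ V_m(r′) + (‖s‖ + 2√(m+1)) V_m(R′)`,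
`R′ = √(QΔ) + √(m+1) + 1`, `r′ = √((Q−m−1)Δ) − √(m+1)`) and shows `V(r′) ≤ 2|X|`
(`volume_ball_le_two_mul_card_pointSet`). This file performs the division announced there: with the
scaling `V(R′) = (R′/r′)^{m+1} V(r′)` (`volume_ball_mul_eq`) and the section ratio
`V_m(ρ) ≤ (e^{1/2} √(m+1) / (2ρ)) V(ρ)` (`volume_ball_le_succ`, both `RegevBallGeometry.lean`),

* **`card_filter_sub_notMem_le_mul_card_pointSet`**: `#{x ∈ X | x − s ∉ X} ≤ 2 ε · |X|` with the
  explicit `ε = ((R′/r′)^{m+1} − 1) + (c/r′) ‖s‖ + (c/R′) (‖s‖ + 2√(m+1)) (R′/r′)^{m+1}`,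
  `c = e^{1/2} √(m+1) / 2` (`shiftEps`), valid whenever `r′ > 0` (`m ≥ 1`, `Q ≥ m + 1`, `Δ ≥ 1`).

Choosing `Q` (the number of levels) polynomially large makes `(R′/r′)^{m+1} − 1` and `c √(m+1)/r′`
as small as any prescribed inverse polynomial; that choice belongs to the assembly of Lemma 3.12.

## References

* O. Regev, *Quantum computation and lattice problems*, SIAM J. Comput. 33 (2004) 738–760,
  Claims 3.7–3.8, Cor. 3.9 (p. 10) and Claim 3.14 (p. 15) [Regev2004].
-/

noncomputable section

namespace Literature.Algebra.EuclideanLattices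

namespace Regev2004

open _root_.MeasureTheory Metric Finset

variable {m : ℕ}

/-- The outer radius `R′ = √(QΔ) + √(m+1) + 1` of the shift estimate. [cite: Regev2004, Claim 3.14 (proof, p. 15)] -/
def outerRad (m Q Δ : ℕ) : ℝ := Real.sqrt ((Q : ℝ) * Δ) + Real.sqrt (m + 1 : ℝ) + 1

/-- The inner radius `r′ = √((Q − m − 1)Δ) − √(m+1)` of the shift estimate. [cite: Regev2004, Cor. 3.9 (proof)] -/
def innerRad (m Q Δ : ℕ) : ℝ := Real.sqrt (((Q : ℝ) - (m + 1)) * Δ) - Real.sqrt (m + 1 : ℝ)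

/-- The section-ratio constant `c = e^{1/2} √(m+1) / 2` (`V_m(ρ) ≤ (c/ρ) V_{m+1}(ρ)`). [cite: Regev2004, Claim 3.7 (proof, p. 10)] -/
def secConst (m : ℕ) : ℝ := Real.exp (1 / 2) * Real.sqrt (m + 1 : ℝ) / 2

/-- **The relative shift error** `ε(s)`:
`((R′/r′)^{m+1} − 1) + (c/r′) ‖s‖ + (c/R′) (‖s‖ + 2√(m+1)) (R′/r′)^{m+1}`. [cite: Regev2004, Claim 3.14 (p. 15: the two error terms)] -/
def shiftEps (m Q Δ : ℕ) (σ : ℝ) : ℝ :=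
  ((outerRad m Q Δ / innerRad m Q Δ) ^ (m + 1) - 1) + secConst m / innerRad m Q Δ * σ +
    secConst m / outerRad m Q Δ * (σ + 2 * Real.sqrt (m + 1 : ℝ)) * (outerRad m Q Δ / innerRad m Q Δ) ^ (m + 1)

/-- The outer radius is positive. [folklore] -/
theorem outerRad_pos (m Q Δ : ℕ) : 0 < outerRad m Q Δ := by
  unfold outerRad; positivity

/-- The inner radius is below the outer one. [folklore] -/
theorem innerRad_le_outerRad (m Q Δ : ℕ) : innerRad m Q Δ ≤ outerRad m Q Δ := by
  unfold innerRad outerRad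
  have h1 : Real.sqrt (((Q : ℝ) - (m + 1)) * Δ) ≤ Real.sqrt ((Q : ℝ) * Δ) :=
    Real.sqrt_le_sqrt (by nlinarith [(Nat.cast_nonneg Δ : (0 : ℝ) ≤ Δ), (by positivity : (0 : ℝ) ≤ (m : ℝ) + 1)])
  have h2 : 0 ≤ Real.sqrt (m + 1 : ℝ) := Real.sqrt_nonneg _
  linarith

/-- **Claim 3.14 for the point set, as a fraction**: for `r′ > 0`,
`#{x ∈ X | x − s ∉ X} ≤ 2 ε(‖s‖) · |X|`, `X = pointSet (m+1) Q Δ`, with the explicit `ε` of `shiftEps`.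
[cite: Regev2004, Claim 3.14 (p. 15) with Cor. 3.9 and Claim 3.7 (p. 10)] -/
theorem card_filter_sub_notMem_le_mul_card_pointSet {Q Δ : ℕ} (hΔ : 0 < Δ) (hm : 0 < m) (hQ : m + 1 ≤ Q)
    (hr : 0 < innerRad m Q Δ) (s : Fin (m + 1) → ℤ) :
    (((pointSet (m + 1) Q Δ hΔ).filter fun x => x - s ∉ pointSet (m + 1) Q Δ hΔ).card : ENNReal) ≤
      ENNReal.ofReal (2 * shiftEps m Q Δ ‖intVecToEuclidean (m + 1) s‖) * ((pointSet (m + 1) Q Δ hΔ).card : ENNReal) := by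
  set R := outerRad m Q Δ with hR
  set r := innerRad m Q Δ with hr'
  set c := secConst m with hc
  set σ := ‖intVecToEuclidean (m + 1) s‖ with hσ
  set q := R / r with hq
  set V : ENNReal := volume (ball (0 : EuclideanSpace ℝ (Fin (m + 1))) r) with hV
  have hRpos : 0 < R := outerRad_pos m Q Δ
  have hq1 : 1 ≤ q := by rw [hq, le_div_iff₀ hr, one_mul]; exact innerRad_le_outerRad m Q Δ
  have hqpos : 0 < q := lt_of_lt_of_le one_pos hq1
  have hc0 : 0 ≤ c := by rw [hc]; unfold secConst; positivity
  have hσ0 : 0 ≤ σ := norm_nonneg _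
  have hsq : 0 ≤ Real.sqrt (m + 1 : ℝ) := Real.sqrt_nonneg _
  -- the three volumes in terms of `V`
  have hVR : volume (ball (0 : EuclideanSpace ℝ (Fin (m + 1))) R) = ENNReal.ofReal (q ^ (m + 1)) * V := by
    rw [show R = q * r by rw [hq]; field_simp, volume_ball_mul_eq (m + 1) hqpos r]
  have hVm_r : volume (ball (0 : EuclideanSpace ℝ (Fin m)) r) ≤ ENNReal.ofReal (c / r) * V := by
    have h := volume_ball_le_succ m hm hr
    rw [hc]
    unfold secConst
    convert h using 3
    field_simp
  have hVm_R : volume (ball (0 : EuclideanSpace ℝ (Fin m)) R) ≤ ENNReal.ofReal (c / R * q ^ (m + 1)) * V := by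
    have h := volume_ball_le_succ m hm hRpos
    rw [hVR, ← mul_assoc, ← ENNReal.ofReal_mul (by positivity)] at h
    rw [hc]
    unfold secConst
    convert h using 3
    field_simp
  have hVfin : V ≠ ⊤ := (measure_ball_lt_top).ne
  -- the shell
  have hshell : volume (ball (0 : EuclideanSpace ℝ (Fin (m + 1))) R) - V ≤ ENNReal.ofReal (q ^ (m + 1) - 1) * V := by
    rw [hVR, ENNReal.ofReal_sub _ zero_le_one, ENNReal.ofReal_one]
    rw [ENNReal.sub_mul fun _ _ => hVfin, one_mul]
  -- assemble
  have hmain := card_filter_sub_notMem_le_volume hΔ hQ s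
  have e1 : Real.sqrt ((Q : ℝ) * Δ) + Real.sqrt (m + 1 : ℝ) + 1 = R := rfl
  have e2 : Real.sqrt (((Q : ℝ) - (m + 1)) * Δ) - Real.sqrt (m + 1 : ℝ) = r := rfl
  rw [e1, e2, ← hσ, ← hV] at hmain
  calc (((pointSet (m + 1) Q Δ hΔ).filter fun x => x - s ∉ pointSet (m + 1) Q Δ hΔ).card : ENNReal)
      ≤ (volume (ball (0 : EuclideanSpace ℝ (Fin (m + 1))) R) - V) + ENNReal.ofReal σ * volume (ball (0 : EuclideanSpace ℝ (Fin m)) r) +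
          ENNReal.ofReal (σ + 2 * Real.sqrt (m + 1 : ℝ)) * volume (ball (0 : EuclideanSpace ℝ (Fin m)) R) := hmain
    _ ≤ ENNReal.ofReal (q ^ (m + 1) - 1) * V + ENNReal.ofReal σ * (ENNReal.ofReal (c / r) * V) +
          ENNReal.ofReal (σ + 2 * Real.sqrt (m + 1 : ℝ)) * (ENNReal.ofReal (c / R * q ^ (m + 1)) * V) := by
        gcongr
    _ = ENNReal.ofReal (shiftEps m Q Δ σ) * V := by
        rw [← mul_assoc, ← mul_assoc, ← ENNReal.ofReal_mul hσ0, ← ENNReal.ofReal_mul (by positivity), ← add_mul, ← add_mul,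
          ← ENNReal.ofReal_add (by nlinarith [one_le_pow₀ (n := m + 1) hq1]) (by positivity),
          ← ENNReal.ofReal_add (by have := one_le_pow₀ (n := m + 1) hq1; positivity) (by positivity)]
        congr 1
        rw [shiftEps, ← hR, ← hr', ← hc, ← hq]
        ring_nf
    _ ≤ ENNReal.ofReal (shiftEps m Q Δ σ) * (2 * ((pointSet (m + 1) Q Δ hΔ).card : ENNReal)) := by
        gcongr
        exact volume_ball_le_two_mul_card_pointSet hΔ hQ
    _ = ENNReal.ofReal (2 * shiftEps m Q Δ σ) * ((pointSet (m + 1) Q Δ hΔ).card : ENNReal) := by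
        rw [ENNReal.ofReal_mul zero_le_two, ENNReal.ofReal_ofNat]
        ring

end Regev2004

end Literature.Algebra.EuclideanLattices
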